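import Summits.HodgeConjecture.CorCM.Census.CentralSquaresNearLatticePow
import Summits.HodgeConjecture.CorCM.Census.CoverClosureMeta

/-!
# The square-central class, XLIX: residual closure of a base block with SEVERAL partner types (the multi-partner / eight-type frame, I)

COR-CM (cell `pub-hodgecm2`), count-neutral kernel combinatorics by the binder seat b09 (gen 50; lane SQUARE-CENTRAL CLASS, part XLIX), on part XXIV
(`Census/CentralSquaresNearLatticePow.lean`: the four base defects with an arbitrary multiplier, `residual_closure_four_pow`), part II
(`Census/CentralSquaresNearLattice.lean`: star defects `ρ(X) = [X] − θ_{T₀}(typeSum [X])`, `two_pow_smul_mem_of_defects`, the defect calculus) and part 0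
(`Census/CoverClosureMeta.lean`: the cover-closure law `isLeast_card_gfaces_generate_of_cover_closure`, `residual_cases`), all BY NAME.  Theorems only: no
definition, no `decide`, no certificate, no named fact, no `sorry`.  HONEST FRAMING: `HC_CM` is NOT proved, here or anywhere in the tree; nothing here is a
period or a headline — these are census laws `μ(G, c)` for the face-relation lattice.

WHY.  Every frame law of the lane so far (the four-type law VIII, the dihedral law XLVI, the order-four, orbit and mixed frame laws) lives on a FOUR-type
base block `{T₀, T̄₀, T₁, T̄₁}`: one partner `T₁` of the base type.  The rows of the square-central class still open — `Q₈ × E`, Pauli `× E`,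
`2^{1+4}_± × E`, … (successor item (vi) of `DIHEDRAL-LAW.md`, item (D) of `SMALL-INDEX-AND-SPECTATOR.md`) — have affine base blocks of `8` (rank two) or `16`
(rank three) types: the base type `T₀` has SEVERAL partners `T₁, …, T_r` (`r = 3, 7, …`), each at distance `n/2 = 2m` from `T₀`, together with their
complements.  This file is the model-free first brick of that «multi-partner frame»: the residual Hodge lattice of such a block is closed, up to `2ᵏ`, by
the four-type relation families of the partners SEPARATELY — no relation mixing two partners is needed.

* §1 `smul_defect_mem_of_partner` (any multiplier `N`): from the pairs, `N·Y_s` (`s ∈ T₀ ∖ T₁`), `N·Y'_s` (`s ∈ T₀ ∩ T₁`), ONE transversal relation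
  `R(T)` and ONE `Rᶜ(T')` of the partner `T₁`, the star defect `ρ(X)` of EVERY type `X` of the four-type class of `(T₀, T₁)` — `T₀, T̄₀, T₁, T̄₁` and all
  their single flips — lies in `L` up to `N` (the computation inside part XXIVʼs `residual_closure_four_pow`, exported per type).
* §2 **MULTI-PARTNER RESIDUAL CLOSURE** (`residual_closure_partners_pow`): for a nonempty finite set `𝒯` of partners of `T₀`, each with
  `|T₀ ∖ T₁| = |T₀ ∩ T₁| = 2m` and its four families in `L` (multiplier `2ᵏ`), every Hodge vector supported on `T₀`, `T̄₀`, the partners, their complements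
  and all their single flips lies in `L` up to `2ᵏ` (part IIʼs defect closure over the union of the four-type classes).
* §3 **THE SOCKET** (`residual_closure_partners_bpot`): if the base changes of `T₀` are exactly `T₀`, `T̄₀`, the partners and their complements, this is
  the residual-closure hypothesis of the cover-closure law verbatim (`bpot T₀ Ψ ≤ 1`); hence (`isLeast_card_gfaces_generate_of_partners`) for a `2`-group
  **`μ(G, c) = φ₂(G, c)`** as soon as every lowering cover of `T₀` supplies the four families of every partner.

NUMERICS (this generation, `HOME/pub-hodgecm2-b09/lean-g50/py/eight.py`, Boolean model, `n = 16`, `m = 4`): for `2^{1+4}_+` and Pauli `× ℤ/2` the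
canonical and random lowering covers supply, for every one of the three partners, `2Y_s` (all `s`), `R(T)` for `38/70` of the `m`-subsets `T` (`2R(T)` for
all), `Rᶜ` likewise — near rank `52/52`, Smith `[2,2,2]`, index `8`, cover-independent; for `Q₈ × ℤ/2²` (all swaps of quaternion type) none of them (near
rank `8/52`): there the `d₂ = 2` budget of five closers is needed.  HC_CM is NOT proved; nothing here is a period.

## References
* [Pohlmann1968] H. Pohlmann, Algebraic cycles on abelian varieties of complex multiplication type, Ann. of Math. 88 (1968), Thm 1.
-/

namespace Summit.HodgeConjecture.CorCM.Census.CentralSquares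

open Finset
open scoped symmDiff
open Summit.HodgeConjecture.CorCM.Prior.AllgGroup.RfwfAllgGroup
open Summit.HodgeConjecture.CorCM.Census.BlockParity
open Summit.HodgeConjecture.CorCM.Census.Coinvariant
open Summit.HodgeConjecture.CorCM.Census.TwistGeneration
open Summit.HodgeConjecture.CorCM.Census.BaseBlock
open Summit.HodgeConjecture.CorCM.Census.CoverClosure

noncomputable section

variable {G : Type*} [Group G] [Fintype G] [DecidableEq G] (c : G)

/-! ## §1 The star defects of the four-type class of one partner -/

/-- **Defects of one partnerʼs four-type class.**  From the pairs, `N·Y_s` (`s ∈ 𝓗 = T₀ ∖ T₁`), `N·Y'_s` (`s ∈ T₀ ∩ T₁`), one `R(T)` (`T ⊆ 𝓗`, `|T| = m`)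
and one `Rᶜ(T')` (`T' ⊆ T₀ ∩ T₁`, `|T'| = m`): `N·ρ(X) ∈ L` for every `X` among `T₀, T̄₀, T₁, T̄₁` and their single flips
(`ρ(X) = [X] − θ_{T₀}(typeSum [X])`).  This is part XXIVʼs computation, exported type by type. [folklore] -/
theorem smul_defect_mem_of_partner (hc2 : c * c = 1) (hcen : ∀ x : G, x * c = c * x) (T₀ T₁ : CMF G c)
    (L : Submodule ℤ (CMF G c →₀ ℤ)) (hP : ∀ Ψ : CMF G c, pair c Ψ ∈ L) (N : ℤ) (m : ℕ)
    (hH : (T₀.1 \ T₁.1).card = 2 * m) (hHc : (T₀.1 ∩ T₁.1).card = 2 * m)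
    (hY : ∀ s ∈ T₀.1 \ T₁.1, N • ((Finsupp.single (oflipCM c hc2 s T₀) (1 : ℤ) - Finsupp.single T₀ 1) +
      (Finsupp.single (oflipCM c hc2 s T₁) (1 : ℤ) - Finsupp.single T₁ 1)) ∈ L)
    (hY' : ∀ s ∈ T₀.1 ∩ T₁.1, N • ((Finsupp.single (oflipCM c hc2 s T₀) (1 : ℤ) - Finsupp.single T₀ 1) -
      (Finsupp.single (oflipCM c hc2 s T₁) (1 : ℤ) - Finsupp.single T₁ 1)) ∈ L)
    (hR : ∃ T : Finset G, T ⊆ T₀.1 \ T₁.1 ∧ T.card = m ∧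
      ∑ s ∈ T, Finsupp.single (oflipCM c hc2 s T₀) (1 : ℤ) - ∑ u ∈ (T₀.1 \ T₁.1) \ T, Finsupp.single (oflipCM c hc2 u T₁) (1 : ℤ) -
        ((m : ℤ) - 1) • (Finsupp.single T₀ (1 : ℤ) - Finsupp.single T₁ 1) ∈ L)
    (hRc : ∃ T' : Finset G, T' ⊆ T₀.1 ∩ T₁.1 ∧ T'.card = m ∧
      ∑ s ∈ T', Finsupp.single (oflipCM c hc2 s T₀) (1 : ℤ) + ∑ u ∈ (T₀.1 ∩ T₁.1) \ T', Finsupp.single (oflipCM c hc2 u T₁) (1 : ℤ) -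
        ((m : ℤ) - 1) • (Finsupp.single T₀ (1 : ℤ) + Finsupp.single T₁ 1) ∈ L) :
    ∀ X : CMF G c, (X = T₀ ∨ X = T₁ ∨ X = rt c c T₀ ∨ X = rt c c T₁ ∨
      ∃ s : G, X = oflipCM c hc2 s T₀ ∨ X = oflipCM c hc2 s T₁ ∨ X = oflipCM c hc2 s (rt c c T₀) ∨ X = oflipCM c hc2 s (rt c c T₁)) →
      N • (Finsupp.single X 1 - thetaG c hc2 T₀ (typeSum G c (Finsupp.single X 1))) ∈ L := by
  classical
  obtain ⟨T, hT, hTm, hRT⟩ := hR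
  obtain ⟨T', hT', hT'm, hRT'⟩ := hRc
  -- the defects of the four base types
  have hρ₁ := smul_defect_T₁_mem c hc2 T₀ T₁ L N m hH hT hTm hRT fun t ht => hY t (mem_sdiff.mp ht).1
  have hσ := smul_sigma_mem c hc2 T₀ T₁ L N m hHc hT' hT'm hRT' fun t ht => hY' t (mem_sdiff.mp ht).1
  have hρ₀c := smul_defect_compl_T₀_mem c hc2 T₀ T₁ hcen L hP N hρ₁ hσ
  -- defect of any flip of `T₁`
  have hflip₁ : ∀ s : G, N • (Finsupp.single (oflipCM c hc2 s T₁) 1 -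
      thetaG c hc2 T₀ (typeSum G c (Finsupp.single (oflipCM c hc2 s T₁) 1))) ∈ L := by
    suffices h : ∀ s ∈ T₀.1, N • (Finsupp.single (oflipCM c hc2 s T₁) 1 -
        thetaG c hc2 T₀ (typeSum G c (Finsupp.single (oflipCM c hc2 s T₁) 1))) ∈ L by
      intro s
      by_cases hs : s ∈ T₀.1
      · exact h s hs
      · have hcs : c * s ∈ T₀.1 := by by_contra h'; exact hs ((T₀.2 s).mpr h')
        have e : oflipCM c hc2 s T₁ = oflipCM c hc2 (c * s) T₁ := (oflipCM_cmul c hc2 s T₁).symm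
        rw [e]; exact h (c * s) hcs
    intro s hs
    by_cases hs1 : s ∈ T₁.1
    · exact smul_defect_oflipCM_T₁_mem_of_mem_inter c hc2 T₀ T₁ L N (mem_inter.mpr ⟨hs, hs1⟩) hρ₁ (hY' s (mem_inter.mpr ⟨hs, hs1⟩))
    · exact smul_defect_oflipCM_T₁_mem_of_mem_sdiff c hc2 T₀ T₁ L N (mem_sdiff.mpr ⟨hs, hs1⟩) hρ₁ (hY s (mem_sdiff.mpr ⟨hs, hs1⟩))
  -- defect of any flip of `T₀` vanishes
  have hflip₀ : ∀ s : G, N • (Finsupp.single (oflipCM c hc2 s T₀) 1 -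
      thetaG c hc2 T₀ (typeSum G c (Finsupp.single (oflipCM c hc2 s T₀) 1))) ∈ L := by
    intro s
    by_cases hs : s ∈ T₀.1
    · rw [defect_oflipCM_base c hc2 T₀ hs, smul_zero]; exact Submodule.zero_mem _
    · have hcs : c * s ∈ T₀.1 := by by_contra h'; exact hs ((T₀.2 s).mpr h')
      rw [← oflipCM_cmul c hc2 s T₀, defect_oflipCM_base c hc2 T₀ hcs, smul_zero]; exact Submodule.zero_mem _
  -- complements
  have hcompl : ∀ X : CMF G c, N • (Finsupp.single X 1 - thetaG c hc2 T₀ (typeSum G c (Finsupp.single X 1))) ∈ L →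
      N • (Finsupp.single (rt c c X) 1 - thetaG c hc2 T₀ (typeSum G c (Finsupp.single (rt c c X) 1))) ∈ L := by
    intro X hX
    rw [defect_compl c hc2 hcen T₀ X, smul_add, smul_sub, smul_sub]
    exact Submodule.add_mem _ (Submodule.sub_mem _ (Submodule.sub_mem _ (Submodule.smul_mem _ _ (hP X))
      (Submodule.smul_mem _ _ (hP T₀))) hX) hρ₀c
  intro X hX
  rcases hX with rfl | rfl | rfl | rfl | ⟨s, rfl | rfl | rfl | rfl⟩
  · rw [defect_base, smul_zero]; exact Submodule.zero_mem _
  · exact hρ₁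
  · exact hρ₀c
  · exact hcompl T₁ hρ₁
  · exact hflip₀ s
  · exact hflip₁ s
  · rw [oflipCM_rt_self c hc2 hcen]; exact hcompl _ (hflip₀ s)
  · rw [oflipCM_rt_self c hc2 hcen]; exact hcompl _ (hflip₁ s)

/-! ## §2 Multi-partner residual closure -/

/-- **MULTI-PARTNER RESIDUAL CLOSURE.**  `T₀` a base type, `𝒯` a NONEMPTY finite set of partner types, each `T₁ ∈ 𝒯` with `|T₀ ∖ T₁| = |T₀ ∩ T₁| = 2m`
and its four-type relation families in `L ⊇ ℤ⟨pairs⟩` — `2ᵏY_s` (`s ∈ T₀ ∖ T₁`), `2ᵏY'_s` (`s ∈ T₀ ∩ T₁`), one `R(T)`, one `Rᶜ(T')`.  Then every Hodge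
vector supported on `T₀`, `T̄₀`, the partners, their complements and the single flips of all these types lies in `L` up to `2ᵏ`.  (The residual lattice
of an eight-type (rank-two affine) block: three partners; of a sixteen-type block: seven.) [folklore] -/
theorem residual_closure_partners_pow (hc2 : c * c = 1) (hc1 : c ≠ 1) (hcen : ∀ x : G, x * c = c * x) (T₀ : CMF G c)
    (𝒯 : Finset (CMF G c)) (h𝒯 : 𝒯.Nonempty)
    (L : Submodule ℤ (CMF G c →₀ ℤ)) (hP : ∀ Ψ : CMF G c, pair c Ψ ∈ L) (k m : ℕ)
    (hH : ∀ T₁ ∈ 𝒯, (T₀.1 \ T₁.1).card = 2 * m) (hHc : ∀ T₁ ∈ 𝒯, (T₀.1 ∩ T₁.1).card = 2 * m)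
    (hY : ∀ T₁ ∈ 𝒯, ∀ s ∈ T₀.1 \ T₁.1, ((2 : ℤ) ^ k) • ((Finsupp.single (oflipCM c hc2 s T₀) (1 : ℤ) - Finsupp.single T₀ 1) +
      (Finsupp.single (oflipCM c hc2 s T₁) (1 : ℤ) - Finsupp.single T₁ 1)) ∈ L)
    (hY' : ∀ T₁ ∈ 𝒯, ∀ s ∈ T₀.1 ∩ T₁.1, ((2 : ℤ) ^ k) • ((Finsupp.single (oflipCM c hc2 s T₀) (1 : ℤ) - Finsupp.single T₀ 1) -
      (Finsupp.single (oflipCM c hc2 s T₁) (1 : ℤ) - Finsupp.single T₁ 1)) ∈ L)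
    (hR : ∀ T₁ ∈ 𝒯, ∃ T : Finset G, T ⊆ T₀.1 \ T₁.1 ∧ T.card = m ∧
      ∑ s ∈ T, Finsupp.single (oflipCM c hc2 s T₀) (1 : ℤ) - ∑ u ∈ (T₀.1 \ T₁.1) \ T, Finsupp.single (oflipCM c hc2 u T₁) (1 : ℤ) -
        ((m : ℤ) - 1) • (Finsupp.single T₀ (1 : ℤ) - Finsupp.single T₁ 1) ∈ L)
    (hRc : ∀ T₁ ∈ 𝒯, ∃ T' : Finset G, T' ⊆ T₀.1 ∩ T₁.1 ∧ T'.card = m ∧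
      ∑ s ∈ T', Finsupp.single (oflipCM c hc2 s T₀) (1 : ℤ) + ∑ u ∈ (T₀.1 ∩ T₁.1) \ T', Finsupp.single (oflipCM c hc2 u T₁) (1 : ℤ) -
        ((m : ℤ) - 1) • (Finsupp.single T₀ (1 : ℤ) + Finsupp.single T₁ 1) ∈ L) :
    ∀ y ∈ hodgeSpan c hc2, (∀ Ψ ∈ y.support, Ψ = T₀ ∨ Ψ = rt c c T₀ ∨
      (∃ s : G, Ψ = oflipCM c hc2 s T₀ ∨ Ψ = oflipCM c hc2 s (rt c c T₀)) ∨
      ∃ T₁ ∈ 𝒯, Ψ = T₁ ∨ Ψ = rt c c T₁ ∨ ∃ s : G, Ψ = oflipCM c hc2 s T₁ ∨ Ψ = oflipCM c hc2 s (rt c c T₁)) →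
      ((2 : ℤ) ^ k) • y ∈ L := by
  classical
  -- the per-partner defect lemma, specialised
  have hpart : ∀ T₁ ∈ 𝒯, ∀ X : CMF G c, (X = T₀ ∨ X = T₁ ∨ X = rt c c T₀ ∨ X = rt c c T₁ ∨
      ∃ s : G, X = oflipCM c hc2 s T₀ ∨ X = oflipCM c hc2 s T₁ ∨ X = oflipCM c hc2 s (rt c c T₀) ∨ X = oflipCM c hc2 s (rt c c T₁)) →
      ((2 : ℤ) ^ k) • (Finsupp.single X 1 - thetaG c hc2 T₀ (typeSum G c (Finsupp.single X 1))) ∈ L :=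
    fun T₁ hT₁ => smul_defect_mem_of_partner c hc2 hcen T₀ T₁ L hP ((2 : ℤ) ^ k) m (hH T₁ hT₁) (hHc T₁ hT₁) (hY T₁ hT₁) (hY' T₁ hT₁)
      (hR T₁ hT₁) (hRc T₁ hT₁)
  obtain ⟨T₁, hT₁⟩ := h𝒯
  refine two_pow_smul_mem_of_defects c hc2 hc1 hcen T₀ L hP
    (fun Ψ => Ψ = T₀ ∨ Ψ = rt c c T₀ ∨ (∃ s : G, Ψ = oflipCM c hc2 s T₀ ∨ Ψ = oflipCM c hc2 s (rt c c T₀)) ∨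
      ∃ T₁ ∈ 𝒯, Ψ = T₁ ∨ Ψ = rt c c T₁ ∨ ∃ s : G, Ψ = oflipCM c hc2 s T₁ ∨ Ψ = oflipCM c hc2 s (rt c c T₁))
    (Or.inl rfl) (Or.inr (Or.inl rfl)) k fun X hX => ?_
  rcases hX with h | h | ⟨s, h | h⟩ | ⟨T₂, hT₂, h | h | ⟨s, h | h⟩⟩
  · exact hpart T₁ hT₁ X (Or.inl h)
  · exact hpart T₁ hT₁ X (Or.inr (Or.inr (Or.inl h)))
  · exact hpart T₁ hT₁ X (Or.inr (Or.inr (Or.inr (Or.inr ⟨s, Or.inl h⟩))))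
  · exact hpart T₁ hT₁ X (Or.inr (Or.inr (Or.inr (Or.inr ⟨s, Or.inr (Or.inr (Or.inl h))⟩))))
  · exact hpart T₂ hT₂ X (Or.inr (Or.inl h))
  · exact hpart T₂ hT₂ X (Or.inr (Or.inr (Or.inr (Or.inl h))))
  · exact hpart T₂ hT₂ X (Or.inr (Or.inr (Or.inr (Or.inr ⟨s, Or.inr (Or.inl h)⟩))))
  · exact hpart T₂ hT₂ X (Or.inr (Or.inr (Or.inr (Or.inr ⟨s, Or.inr (Or.inr (Or.inr h))⟩))))

/-! ## §3 The socket: base changes = the partners and their complements -/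

/-- **THE SOCKET.**  If the base changes of `T₀` are exactly `T₀`, `T̄₀`, the partners `T₁ ∈ 𝒯` and their complements, the multi-partner residual closure is
the residual-closure hypothesis of the cover-closure law (part 0) verbatim: every Hodge vector supported on types of potential `≤ 1` lies in `L` up to `2ᵏ`.
[folklore] -/
theorem residual_closure_partners_bpot (hc2 : c * c = 1) (hc1 : c ≠ 1) (hcen : ∀ x : G, x * c = c * x) (T₀ : CMF G c)
    (𝒯 : Finset (CMF G c)) (h𝒯 : 𝒯.Nonempty)
    (hbase : ∀ Q : G, rt c Q T₀ = T₀ ∨ rt c Q T₀ = rt c c T₀ ∨ ∃ T₁ ∈ 𝒯, rt c Q T₀ = T₁ ∨ rt c Q T₀ = rt c c T₁)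
    (L : Submodule ℤ (CMF G c →₀ ℤ)) (hP : ∀ Ψ : CMF G c, pair c Ψ ∈ L) (k m : ℕ)
    (hH : ∀ T₁ ∈ 𝒯, (T₀.1 \ T₁.1).card = 2 * m) (hHc : ∀ T₁ ∈ 𝒯, (T₀.1 ∩ T₁.1).card = 2 * m)
    (hY : ∀ T₁ ∈ 𝒯, ∀ s ∈ T₀.1 \ T₁.1, ((2 : ℤ) ^ k) • ((Finsupp.single (oflipCM c hc2 s T₀) (1 : ℤ) - Finsupp.single T₀ 1) +
      (Finsupp.single (oflipCM c hc2 s T₁) (1 : ℤ) - Finsupp.single T₁ 1)) ∈ L)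
    (hY' : ∀ T₁ ∈ 𝒯, ∀ s ∈ T₀.1 ∩ T₁.1, ((2 : ℤ) ^ k) • ((Finsupp.single (oflipCM c hc2 s T₀) (1 : ℤ) - Finsupp.single T₀ 1) -
      (Finsupp.single (oflipCM c hc2 s T₁) (1 : ℤ) - Finsupp.single T₁ 1)) ∈ L)
    (hR : ∀ T₁ ∈ 𝒯, ∃ T : Finset G, T ⊆ T₀.1 \ T₁.1 ∧ T.card = m ∧
      ∑ s ∈ T, Finsupp.single (oflipCM c hc2 s T₀) (1 : ℤ) - ∑ u ∈ (T₀.1 \ T₁.1) \ T, Finsupp.single (oflipCM c hc2 u T₁) (1 : ℤ) -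
        ((m : ℤ) - 1) • (Finsupp.single T₀ (1 : ℤ) - Finsupp.single T₁ 1) ∈ L)
    (hRc : ∀ T₁ ∈ 𝒯, ∃ T' : Finset G, T' ⊆ T₀.1 ∩ T₁.1 ∧ T'.card = m ∧
      ∑ s ∈ T', Finsupp.single (oflipCM c hc2 s T₀) (1 : ℤ) + ∑ u ∈ (T₀.1 ∩ T₁.1) \ T', Finsupp.single (oflipCM c hc2 u T₁) (1 : ℤ) -
        ((m : ℤ) - 1) • (Finsupp.single T₀ (1 : ℤ) + Finsupp.single T₁ 1) ∈ L) :
    ∀ y ∈ hodgeSpan c hc2, (∀ Ψ ∈ y.support, bpot c T₀ Ψ ≤ 1) → ((2 : ℤ) ^ k) • y ∈ L := by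
  intro y hy hyR
  refine residual_closure_partners_pow c hc2 hc1 hcen T₀ 𝒯 h𝒯 L hP k m hH hHc hY hY' hR hRc y hy fun Ψ hΨ => ?_
  rcases residual_cases c T₀ hc2 (hyR Ψ hΨ) with ⟨Q', rfl⟩ | ⟨Q', s, -, rfl⟩
  · rcases hbase Q' with h | h | ⟨T₁, hT₁, h | h⟩
    · exact Or.inl h
    · exact Or.inr (Or.inl h)
    · exact Or.inr (Or.inr (Or.inr ⟨T₁, hT₁, Or.inl h⟩))
    · exact Or.inr (Or.inr (Or.inr ⟨T₁, hT₁, Or.inr (Or.inl h)⟩))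
  · rw [rt_oflipCM]
    rcases hbase Q' with h | h | ⟨T₁, hT₁, h | h⟩
    · exact Or.inr (Or.inr (Or.inl ⟨s * Q'⁻¹, Or.inl (by rw [h])⟩))
    · exact Or.inr (Or.inr (Or.inl ⟨s * Q'⁻¹, Or.inr (by rw [h])⟩))
    · exact Or.inr (Or.inr (Or.inr ⟨T₁, hT₁, Or.inr (Or.inr ⟨s * Q'⁻¹, Or.inl (by rw [h])⟩)⟩))
    · exact Or.inr (Or.inr (Or.inr ⟨T₁, hT₁, Or.inr (Or.inr ⟨s * Q'⁻¹, Or.inr (by rw [h])⟩)⟩))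

/-- **THE MULTI-PARTNER COVER-CLOSURE LAW.**  `G` a finite `2`-group, `c` a central involution `≠ 1`, `T₀` a base type whose base changes are exactly
`T₀`, `T̄₀`, the partners `T₁ ∈ 𝒯 ≠ ∅` and their complements, `|T₀ ∖ T₁| = |T₀ ∩ T₁| = 2m` for every partner.  If for EVERY lowering cover `S` of `T₀` the
lattice `ℤ⟨pairs⟩ + ℤ⟨base changes of S⟩` contains, for every partner, the classes `2ᵏY_s`, `2ᵏY'_s`, one transversal relation `R(T)` and one `Rᶜ(T')`,
then **`μ(G, c) = φ₂(G, c)`**. [folklore] -/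
theorem isLeast_card_gfaces_generate_of_partners (hG : IsPGroup 2 G) (hc2 : c * c = 1) (hc1 : c ≠ 1)
    (hcen : ∀ x : G, x * c = c * x) (T₀ : CMF G c) (𝒯 : Finset (CMF G c)) (h𝒯 : 𝒯.Nonempty)
    (hbase : ∀ Q : G, rt c Q T₀ = T₀ ∨ rt c Q T₀ = rt c c T₀ ∨ ∃ T₁ ∈ 𝒯, rt c Q T₀ = T₁ ∨ rt c Q T₀ = rt c c T₁)
    (k m : ℕ) (hH : ∀ T₁ ∈ 𝒯, (T₀.1 \ T₁.1).card = 2 * m) (hHc : ∀ T₁ ∈ 𝒯, (T₀.1 ∩ T₁.1).card = 2 * m)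
    (hfam : ∀ S : Finset (CMF G c →₀ ℤ), (↑S ⊆ gfaceSet G c hc2) →
      (∀ Ψ : CMF G c, 2 ≤ bpot c T₀ Ψ → ∃ Q s s' : G, bpot c T₀ Ψ = ddist (rt c Q T₀) Ψ ∧
        s ∈ (rt c Q T₀).1 \ Ψ.1 ∧ s' ∈ (rt c Q T₀).1 \ Ψ.1 ∧ s ≠ s' ∧
        gface c hc2 Ψ s s' ∈ Submodule.span ℤ (translates c S)) →
      ∀ T₁ ∈ 𝒯,
        (∀ s ∈ T₀.1 \ T₁.1, ((2 : ℤ) ^ k) • ((Finsupp.single (oflipCM c hc2 s T₀) (1 : ℤ) - Finsupp.single T₀ 1) +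
          (Finsupp.single (oflipCM c hc2 s T₁) (1 : ℤ) - Finsupp.single T₁ 1)) ∈
            Submodule.span ℤ (pairSet c) ⊔ Submodule.span ℤ (translates c S)) ∧
        (∀ s ∈ T₀.1 ∩ T₁.1, ((2 : ℤ) ^ k) • ((Finsupp.single (oflipCM c hc2 s T₀) (1 : ℤ) - Finsupp.single T₀ 1) -
          (Finsupp.single (oflipCM c hc2 s T₁) (1 : ℤ) - Finsupp.single T₁ 1)) ∈
            Submodule.span ℤ (pairSet c) ⊔ Submodule.span ℤ (translates c S)) ∧
        (∃ T : Finset G, T ⊆ T₀.1 \ T₁.1 ∧ T.card = m ∧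
          ∑ s ∈ T, Finsupp.single (oflipCM c hc2 s T₀) (1 : ℤ) - ∑ u ∈ (T₀.1 \ T₁.1) \ T, Finsupp.single (oflipCM c hc2 u T₁) (1 : ℤ) -
            ((m : ℤ) - 1) • (Finsupp.single T₀ (1 : ℤ) - Finsupp.single T₁ 1) ∈
              Submodule.span ℤ (pairSet c) ⊔ Submodule.span ℤ (translates c S)) ∧
        (∃ T' : Finset G, T' ⊆ T₀.1 ∩ T₁.1 ∧ T'.card = m ∧
          ∑ s ∈ T', Finsupp.single (oflipCM c hc2 s T₀) (1 : ℤ) + ∑ u ∈ (T₀.1 ∩ T₁.1) \ T', Finsupp.single (oflipCM c hc2 u T₁) (1 : ℤ) -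
            ((m : ℤ) - 1) • (Finsupp.single T₀ (1 : ℤ) + Finsupp.single T₁ 1) ∈
              Submodule.span ℤ (pairSet c) ⊔ Submodule.span ℤ (translates c S))) :
    IsLeast {n : ℕ | ∃ S : Finset (CMF G c →₀ ℤ), (↑S ⊆ gfaceSet G c hc2) ∧ S.card = n ∧
      hodgeSpan c hc2 ≤ Submodule.span ℤ (pairSet c) ⊔ Submodule.span ℤ (translates c S)} (fibreTwo c hc2) := by
  refine isLeast_card_gfaces_generate_of_cover_closure c hG hc2 hc1 hcen T₀ k fun S hS hlow => ?_
  have hP : ∀ Ψ : CMF G c, pair c Ψ ∈ Submodule.span ℤ (pairSet c) ⊔ Submodule.span ℤ (translates c S) :=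
    fun Ψ => Submodule.mem_sup_left (Submodule.subset_span (pair_mem_pairSet c Ψ))
  have h := hfam S hS hlow
  exact residual_closure_partners_bpot c hc2 hc1 hcen T₀ 𝒯 h𝒯 hbase _ hP k m hH hHc
    (fun T₁ hT₁ => (h T₁ hT₁).1) (fun T₁ hT₁ => (h T₁ hT₁).2.1) (fun T₁ hT₁ => (h T₁ hT₁).2.2.1) (fun T₁ hT₁ => (h T₁ hT₁).2.2.2)

end

end Summit.HodgeConjecture.CorCM.Census.CentralSquares
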